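import Literature.NumberTheory.Automorphic.StrongApproximationSLn
import Literature.RepresentationTheory.HeisenbergGroup.SymplecticSiegelGenerationRestrictedProduct
import Literature.RepresentationTheory.HeisenbergGroup.SymplecticMatrixTransport
import Literature.LinearAlgebra.Matrix.SymplecticIntegerGenerationTranslations
import HarnessLib

/-!
# Strong approximation for `Sp_{2n}`: `Sp_{2n}(K)` is dense in `Sp_{2n}(𝔸_K^∞)`

Topic `NumberTheory/Automorphic`; namespace `Literature.NumberTheory.Automorphic`.  KERNEL ONLY: theorems, no
definition, no named fact, no instance, no `sorry`.  Third instalment of the tree's strong approximation files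
(`StrongApproximationSL2`: `SL₂`; `StrongApproximationSLn`: `SL_n`; `StrongApproximationGL2`: `GL₂/ℚ`), for the
SYMPLECTIC group `Sp_{2l}` (Mathlib's `Matrix.symplecticGroup l A`: the `A ∈ M_{2l}` with `A J Aᵀ = J`,
`J = fromBlocks 0 (-1) 1 0`), i.e. the simply connected group `G = Sp_{2n}` of the strong approximation theorem of
Kneser and Platonov ([PlatonovRapinchuk1994] Thm. 7.12: `G(K)` is dense in `G(𝔸_K^S)` for `G` simply connected,
absolutely almost simple, `G_S` non-compact; [Kneser1966]):

* `symplecticGroup_denseRange_map_finiteAdeleRing` — **for the fraction field `K` of a Dedekind domain `R` and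
  every finite index type `l`, the diagonal image of `Sp_{2l}(K)` is dense in `Sp_{2l}(𝔸_K^∞)`**
  (`𝔸_K^∞ = FiniteAdeleRing R K`, Mathlib's restricted product; the map is the tree's change-of-scalars
  homomorphism `SymplecticMatrix.mapHom (algebraMap K 𝔸_K^∞)`, and `Sp_{2l}(𝔸_K^∞)` carries the topology induced
  from `M_{2l}(𝔸_K^∞)`);
* `exists_symplecticGroup_map_mul_eq_of_isOpen` — the working form **`Sp_{2l}(𝔸_K^∞) = Sp_{2l}(K) · U` for every
  open subgroup `U`**;
* `symplecticGroup_denseRange_map_of_denseRange` — the TRANSFER PRINCIPLE both are instances of: for a ring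
  homomorphism `f : K → A` into a topological commutative ring with dense range, such that `SL_l(K)` is dense in
  `SL_l(A)` along `f` and `A` has the big-cell shift property of `SymplecticSiegelGenerationBigCell` (every symplectic
  `fromBlocks P Q S T` admits a symmetric `X` with `P + X S` invertible), `Sp_{2l}(K)` is dense in `Sp_{2l}(A)`.

The archimedean counterpart (`Sp_{2g}(ℚ)` dense in `Sp_{2g}(ℝ)`, weak approximation) is the tree's
`SymplecticGroupRationalPointsDense.dense_ratPoints`; the two together are what the adelic description of the connected
components of the Siegel modular variety `Sh_K(GSp_{2g}, 𝔥_g^±)(ℂ) = GSp_{2g}(ℚ)∖(𝔥_g^± × GSp_{2g}(𝔸_f)/K)` uses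
([Milne2005ShimuraVarieties] Lemma 5.13, (5.2) and Thm. 5.17: `π₀ ≅ ℚ_{>0}∖𝔸_f^×/ν(K)`, surjectivity of the dissection
into arithmetic quotients `Γ∖𝔥_g` by strong approximation for `G^der = Sp_{2g}`).

## Proof

The closure `H` of the image of `Sp_{2l}(K)` in `Sp_{2l}(A)` is a subgroup (multiplication and the inverse
`g ↦ -J gᵀ J` are continuous).  It contains the three kinds of generators of the tree's
`SymplecticSiegelGeneration` (`m(a) = diag(a, a⁻ᵀ)`, `n(b) = fromBlocks 1 b 0 1`, `J`):
1. `J`, a rational point;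
2. every `n(b)`, `b ∈ Sym_l(A)`: `c ↦ n(sym c)` is a continuous map `M_l(A) → Sp_{2l}(A)` (`sym` the symmetrisation
   copying the entries above a fixed ordering of `l` below it — no `2⁻¹` needed), it carries `M_l(K)` into the image
   of `Sp_{2l}(K)`, `M_l(K)` is dense in `M_l(A)`, and `sym b = b` (`unip_mem_closure_range_mapHom`);
3. every `m(a)`, `a ∈ GL_l(A)`: write `a = d · s` with `d = diag(det a, 1, …, 1)` and `s ∈ SL_l(A)`; `m(s)` lies in `H`
   because `s ↦ m(s)` is continuous and `SL_l(K)` is dense in `SL_l(A)` (`levi_toGL_mem_closure_range_mapHom`; for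
   `A = 𝔸_K^∞` this is the tree's `specialLinearGroup_denseRange_map_finiteAdeleRing`, strong approximation for
   `SL_n`), and `m(d)` lies in `H` because `d` is SYMMETRIC, so that Klingen's identity
   `m(d) = n(-d) v(d⁻¹) n(-d) J⁻¹` of the tree's `levi_mem_of_isSymm_of_unip_mem` writes it in terms of 1 and 2
   (Whitehead's `diag(u, u⁻¹) = w(u) w(-1)` in one hyperbolic plane).
Hence `H = Sp_{2l}(A)` by the tree's `eq_top_of_generators_mem_of_bigCellReachable`; the finite adele ring has the
big-cell shift property as a restricted product of the local rings `K_v`, `𝒪_v`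
(`bigCellReachable_restrictedProduct`, here `FiniteAdeleRing.symplectic_bigCellReachable` for any Dedekind `R`).

## References

* V. Platonov, A. Rapinchuk, *Algebraic groups and number theory*, Academic Press (1994), §7.4, Thm. 7.12
  [PlatonovRapinchuk1994].
* M. Kneser, *Strong approximation*, Proc. Sympos. Pure Math. IX (1966) 187–196 [Kneser1966].
* J. S. Milne, *Introduction to Shimura varieties* (2005), §4 Thm. 4.16, §5 Lemma 5.13, (5.2), Thm. 5.17; §6
  [Milne2005ShimuraVarieties].
* H. Klingen, *Introductory lectures on Siegel modular forms* (1990), §3 Prop. 6 [Klingen1990].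
-/

noncomputable section

open Matrix Topology
open scoped MatrixGroups

namespace Literature.NumberTheory.Automorphic

open Literature.RepresentationTheory.HeisenbergGroup.SymplecticMatrix
open Literature.LinearAlgebra.Matrix.SymplecticMatrix (levi_mem_of_isSymm_of_unip_mem)

variable {l : Type*} [Fintype l] [DecidableEq l]

/-! ### §1. Topology of `Sp_{2l}(A)` over a topological ring: inverse, change of scalars, the Levi map -/

section Topology

variable {A : Type*} [CommRing A] [TopologicalSpace A] [IsTopologicalRing A]

/-- The inverse `g ↦ g⁻¹ = -J gᵀ J` of `Sp_{2l}(A)` is continuous for the topology induced from `M_{2l}(A)`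
(multiplication is continuous as for any submonoid of the topological monoid `M_{2l}(A)`, Mathlib
`Submonoid.continuousMul`), so `Sp_{2l}(A)` is a topological group in the coordinate topology — the topology of
the adele groups `G_A ⊆ M_n(A)`. [cite: PlatonovRapinchuk1994, §5.1 (adele groups, the induced topology)] -/
theorem continuous_symplecticGroup_inv :
    Continuous (fun g : Matrix.symplecticGroup l A => g⁻¹) := by
  refine continuous_induced_rng.2 ?_
  change Continuous (fun g : Matrix.symplecticGroup l A =>
    ((g⁻¹ : Matrix.symplecticGroup l A) : Matrix (l ⊕ l) (l ⊕ l) A))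
  simp only [SymplecticGroup.coe_inv]
  exact (continuous_const.matrix_mul continuous_subtype_val.matrix_transpose).matrix_mul continuous_const

omit [IsTopologicalRing A] in
/-- The change of scalars `Sp_{2l}(f) : Sp_{2l}(A) → Sp_{2l}(B)` (the tree's `SymplecticMatrix.mapHom f`, entrywise)
is continuous when `f` is. [cite: PlatonovRapinchuk1994, §5.1 (adele groups, the induced topology)] -/
theorem continuous_symplecticGroup_mapHom {B : Type*} [CommRing B] [TopologicalSpace B] (f : A →+* B)
    (hf : Continuous f) :
    Continuous (mapHom f : Matrix.symplecticGroup l A → Matrix.symplecticGroup l B) :=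
  continuous_induced_rng.2 (continuous_subtype_val.matrix_map hf)

/-- The Levi map restricted to `SL_l`, `s ↦ m(s) = diag(s, s⁻ᵀ) : SL_l(A) → Sp_{2l}(A)`, is continuous (the entries of
`s⁻¹ = adj s` are polynomials in those of `s`): a morphism of algebraic groups is continuous in the coordinate
topology. [cite: PlatonovRapinchuk1994, §5.1 (adele groups, the induced topology)] -/
theorem continuous_levi_toGL :
    Continuous (fun s : Matrix.SpecialLinearGroup l A =>
      (levi (Matrix.SpecialLinearGroup.toGL s) : Matrix.symplecticGroup l A)) := by
  refine continuous_induced_rng.2 ?_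
  change Continuous (fun s : Matrix.SpecialLinearGroup l A =>
    ((levi (Matrix.SpecialLinearGroup.toGL s) : Matrix.symplecticGroup l A) : Matrix (l ⊕ l) (l ⊕ l) A))
  simp only [coe_levi]
  exact (Units.continuous_val.comp Matrix.SpecialLinearGroup.continuous_toGL).matrix_fromBlocks
    continuous_const continuous_const
    ((Units.continuous_coe_inv.comp Matrix.SpecialLinearGroup.continuous_toGL).matrix_transpose)

end Topology

/-! ### §2. Symmetrisation of a square matrix along an ordering of the indices -/

section Symmetrize

omit [Fintype l] in
/-- The symmetrisation `sym c` of `c ∈ M_l(C)` along an injection `e : l → ℕ` — keep `c i j` if `e i ≤ e j`, else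
copy `c j i` — is symmetric. [folklore] -/
private theorem symmetrize_isSymm {C : Type*} {e : l → ℕ} (he : Function.Injective e) (c : Matrix l l C) :
    (Matrix.of fun i j => if e i ≤ e j then c i j else c j i).IsSymm := by
  ext i j
  simp only [transpose_apply, of_apply]
  by_cases hij : i = j
  · subst hij; rfl
  · have hne : e i ≠ e j := fun h => hij (he h)
    rcases lt_or_gt_of_ne hne with h | h
    · rw [if_neg (not_le.2 h), if_pos h.le]
    · rw [if_pos h.le, if_neg (not_le.2 h)]

omit [Fintype l] [DecidableEq l] in
/-- The symmetrisation of a symmetric matrix is the matrix itself. [folklore] -/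
private theorem symmetrize_eq_self {C : Type*} (e : l → ℕ) {c : Matrix l l C} (hc : c.IsSymm) :
    (Matrix.of fun i j => if e i ≤ e j then c i j else c j i) = c := by
  ext i j
  simp only [of_apply]
  split_ifs
  · rfl
  · exact hc.apply i j

omit [Fintype l] [DecidableEq l] in
/-- Symmetrisation commutes with an entrywise map. [folklore] -/
private theorem symmetrize_map {C D : Type*} (e : l → ℕ) (g : C → D) (c : Matrix l l C) :
    (Matrix.of fun i j => if e i ≤ e j then c.map g i j else c.map g j i) =
      (Matrix.of fun i j => if e i ≤ e j then c i j else c j i).map g := by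
  ext i j
  simp only [of_apply, map_apply]
  split_ifs <;> rfl

omit [Fintype l] [DecidableEq l] in
/-- Symmetrisation is continuous (each entry is a coordinate projection). [folklore] -/
private theorem continuous_symmetrize {C : Type*} [TopologicalSpace C] (e : l → ℕ) :
    Continuous fun c : Matrix l l C => Matrix.of fun i j => if e i ≤ e j then c i j else c j i := by
  refine continuous_matrix fun i j => ?_
  by_cases h : e i ≤ e j
  · simp only [of_apply, if_pos h]
    exact continuous_id.matrix_elem i j
  · simp only [of_apply, if_neg h]
    exact continuous_id.matrix_elem j i

end Symmetrize

/-! ### §3. The transfer principle: `K` dense, `SL_l(K)` dense and the big cell give `Sp_{2l}(K)` dense -/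

section Transfer

variable {K A : Type*} [CommRing K] [CommRing A] [TopologicalSpace A] [IsTopologicalRing A]

omit [IsTopologicalRing A] in
/-- **Every `n(b)`, `b ∈ Sym_l(A)`, lies in the closure of the image of `Sp_{2l}(K)`** when `f : K → A` has dense
range: `c ↦ n(sym c)` is continuous `M_l(A) → Sp_{2l}(A)`, maps `M_l(K)` (dense in `M_l(A)`) into the image, and
`sym b = b`. [cite: PlatonovRapinchuk1994, §7.4 Thm. 7.12 (proof, unipotent subgroups)] -/
theorem unip_mem_closure_range_mapHom (f : K →+* A) (hf : DenseRange f) (b : Matrix l l A) (hb : b.IsSymm) :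
    unip b hb ∈ closure (Set.range (mapHom f : Matrix.symplecticGroup l K → Matrix.symplecticGroup l A)) := by
  classical
  -- an injection `e : l → ℕ` orienting the pairs of indices
  obtain ⟨e, he⟩ : ∃ e : l → ℕ, Function.Injective e :=
    ⟨fun i => ((Fintype.equivFin l i : Fin (Fintype.card l)) : ℕ),
      Fin.val_injective.comp (Fintype.equivFin l).injective⟩
  -- the continuous map `F : c ↦ n(sym c)`
  let F : Matrix l l A → Matrix.symplecticGroup l A := fun c =>
    unip (Matrix.of fun i j => if e i ≤ e j then c i j else c j i) (symmetrize_isSymm he c)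
  have hF : Continuous F := by
    refine continuous_induced_rng.2 ?_
    change Continuous fun c : Matrix l l A => ((F c : Matrix.symplecticGroup l A) : Matrix (l ⊕ l) (l ⊕ l) A)
    simp only [F, coe_unip]
    exact continuous_const.matrix_fromBlocks (continuous_symmetrize e) continuous_const continuous_const
  have hFb : F b = unip b hb := Subtype.ext (by simp only [F, coe_unip, symmetrize_eq_self e hb])
  have hdense : DenseRange (fun c : Matrix l l K => c.map f) :=
    DenseRange.piMap fun _ => DenseRange.piMap fun _ => hf
  rw [← hFb]
  refine map_mem_closure hF (by rw [hdense.closure_range]; exact Set.mem_univ b) ?_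
  rintro _ ⟨c, rfl⟩
  refine ⟨unip (Matrix.of fun i j => if e i ≤ e j then c i j else c j i) (symmetrize_isSymm he c), ?_⟩
  rw [mapHom_unip]
  exact Subtype.ext (by simp only [F, coe_unip, symmetrize_map e f c])

/-- **Every `m(s)`, `s ∈ SL_l(A)`, lies in the closure of the image of `Sp_{2l}(K)`** when `SL_l(K)` is dense in
`SL_l(A)` along `f` (`s ↦ m(s)` is continuous and `m(SL_l(K))` lies in the image).
[cite: PlatonovRapinchuk1994, §7.4 Thm. 7.12] -/
theorem levi_toGL_mem_closure_range_mapHom (f : K →+* A)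
    (hSL : DenseRange (Matrix.SpecialLinearGroup.map f :
      Matrix.SpecialLinearGroup l K → Matrix.SpecialLinearGroup l A))
    (s : Matrix.SpecialLinearGroup l A) :
    (levi (Matrix.SpecialLinearGroup.toGL s) : Matrix.symplecticGroup l A) ∈
      closure (Set.range (mapHom f : Matrix.symplecticGroup l K → Matrix.symplecticGroup l A)) := by
  refine map_mem_closure (f := fun s : Matrix.SpecialLinearGroup l A =>
      (levi (Matrix.SpecialLinearGroup.toGL s) : Matrix.symplecticGroup l A))
    continuous_levi_toGL (by rw [hSL.closure_range]; exact Set.mem_univ s) ?_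
  rintro _ ⟨t, rfl⟩
  refine ⟨levi (Matrix.SpecialLinearGroup.toGL t), ?_⟩
  rw [mapHom_levi]
  exact congrArg levi (Units.ext rfl)

/-- **Every `m(a)`, `a ∈ GL_l(A)`, lies in any subgroup `H` of `Sp_{2l}(A)` containing `J`, all `n(b)` and all `m(s)`,
`s ∈ SL_l(A)`**: `a = d s` with `d = diag(det a, 1, …, 1)` symmetric, so `m(d) ∈ H` by Klingen's identity
`m(d) = n(-d) v(d⁻¹) n(-d) J⁻¹` (the tree's `levi_mem_of_isSymm_of_unip_mem`), and `det s = 1`.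
[cite: Klingen1990, §3 Prop. 6 (proof)] -/
theorem levi_mem_of_unip_mem_of_levi_toGL_mem {B : Type*} [CommRing B] {H : Subgroup (Matrix.symplecticGroup l B)}
    (hn : ∀ (b : Matrix l l B) (hb : b.IsSymm), unip b hb ∈ H) (hJ : SymplecticGroup.symJ l B ∈ H)
    (hs : ∀ s : Matrix.SpecialLinearGroup l B, levi (Matrix.SpecialLinearGroup.toGL s) ∈ H) (a : GL l B) :
    levi a ∈ H := by
  rcases isEmpty_or_nonempty l with _ | ⟨⟨i₀⟩⟩
  · have ha : a = 1 := Subsingleton.elim _ _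
    rw [ha, levi_one]
    exact H.one_mem
  · -- `d = diag(det a, 1, …, 1)`
    set u : Bˣ := Matrix.GeneralLinearGroup.det a with hu
    let d : GL l B :=
      ⟨diagonal fun j => if j = i₀ then (u : B) else 1, diagonal fun j => if j = i₀ then ((u⁻¹ : Bˣ) : B) else 1,
        by
          rw [diagonal_mul_diagonal, ← diagonal_one]
          congr 1; funext j; split_ifs <;> simp,
        by
          rw [diagonal_mul_diagonal, ← diagonal_one]
          congr 1; funext j; split_ifs <;> simp⟩
    have hd_symm : ((d : GL l B) : Matrix l l B).IsSymm := isSymm_diagonal _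
    have hd_det : Matrix.GeneralLinearGroup.det d = u := by
      ext
      rw [Matrix.GeneralLinearGroup.val_det_apply]
      change (diagonal fun j => if j = i₀ then (u : B) else 1).det = u
      rw [det_diagonal, Finset.prod_ite_eq' Finset.univ i₀ (fun _ => (u : B)) ]
      simp
    -- `s = d⁻¹ a ∈ SL_l(B)`
    have hdet1 : (((d⁻¹ * a : GL l B)) : Matrix l l B).det = 1 := by
      rw [← Matrix.GeneralLinearGroup.val_det_apply, map_mul, map_inv, hd_det, hu, inv_mul_cancel, Units.val_one]
    set s : Matrix.SpecialLinearGroup l B := ⟨((d⁻¹ * a : GL l B) : Matrix l l B), hdet1⟩ with hs_def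
    have hs' : Matrix.SpecialLinearGroup.toGL s = d⁻¹ * a := Units.ext rfl
    have ha : a = d * Matrix.SpecialLinearGroup.toGL s := by rw [hs', mul_inv_cancel_left]
    rw [ha, levi_mul]
    exact H.mul_mem (levi_mem_of_isSymm_of_unip_mem hn hJ d hd_symm) (hs s)

/-- **Transfer principle for strong approximation in `Sp_{2l}`.**  Let `f : K → A` be a ring homomorphism into a
topological commutative ring with dense range, such that `SL_l(K)` is dense in `SL_l(A)` along `f` and `A` has the
big-cell shift property (every symplectic `fromBlocks P Q S T` over `A` admits a symmetric `X` with `P + X S`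
invertible — local rings, their products and restricted products: `SymplecticSiegelGenerationBigCell`,
`…RestrictedProduct`).  Then `Sp_{2l}(K)` is dense in `Sp_{2l}(A)`: the closure of the image is a subgroup containing
`J`, the `n(b)` and the `m(a)` (`unip_mem_closure_range_mapHom`, `levi_mem_of_unip_mem_of_levi_toGL_mem`), hence
everything (`eq_top_of_generators_mem_of_bigCellReachable`). [cite: PlatonovRapinchuk1994, §7.4 Thm. 7.12]
[cite: Milne2005ShimuraVarieties, §4 Thm. 4.16] -/
theorem symplecticGroup_denseRange_map_of_denseRange (f : K →+* A) (hf : DenseRange f)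
    (hSL : DenseRange (Matrix.SpecialLinearGroup.map f :
      Matrix.SpecialLinearGroup l K → Matrix.SpecialLinearGroup l A))
    (hA : ∀ ⦃P Q S T : Matrix l l A⦄, fromBlocks P Q S T ∈ Matrix.symplecticGroup l A →
      ∃ X : Matrix l l A, X.IsSymm ∧ IsUnit (P + X * S).det) :
    DenseRange (mapHom f : Matrix.symplecticGroup l K → Matrix.symplecticGroup l A) := by
  classical
  set φ : Matrix.symplecticGroup l K →* Matrix.symplecticGroup l A := mapHom f with hφ
  -- the closure of the image is a subgroup
  let H : Subgroup (Matrix.symplecticGroup l A) :=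
    { carrier := closure (Set.range φ)
      mul_mem' := fun {x y} hx hy =>
        map_mem_closure₂ continuous_mul hx hy (by
          rintro _ ⟨g, rfl⟩ _ ⟨h, rfl⟩
          exact ⟨g * h, map_mul φ g h⟩)
      one_mem' := subset_closure ⟨1, map_one φ⟩
      inv_mem' := fun {x} hx =>
        map_mem_closure continuous_symplecticGroup_inv hx (by
          rintro _ ⟨g, rfl⟩
          exact ⟨g⁻¹, map_inv φ g⟩) }
  have hJ : SymplecticGroup.symJ l A ∈ H := subset_closure ⟨SymplecticGroup.symJ l K, mapHom_J f⟩
  have hn : ∀ (b : Matrix l l A) (hb : b.IsSymm), unip b hb ∈ H := fun b hb =>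
    unip_mem_closure_range_mapHom f hf b hb
  have hm : ∀ a : GL l A, levi a ∈ H :=
    levi_mem_of_unip_mem_of_levi_toGL_mem hn hJ fun s => levi_toGL_mem_closure_range_mapHom f hSL s
  have htop : H = ⊤ := eq_top_of_generators_mem_of_bigCellReachable hA hm hn hJ
  refine dense_iff_closure_eq.2 ?_
  change ((H : Set (Matrix.symplecticGroup l A)) = Set.univ)
  rw [htop, Subgroup.coe_top]

/-- Working form of the transfer principle: under the same hypotheses **`Sp_{2l}(A) = Sp_{2l}(K) · U` for every open
subgroup `U ≤ Sp_{2l}(A)`** (the open set `g U⁻¹ ∋ g` meets the dense image).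
[cite: PlatonovRapinchuk1994, §7.4 Thm. 7.12] -/
theorem exists_symplecticGroup_map_mul_eq_of_denseRange (f : K →+* A)
    (hφ : DenseRange (mapHom f : Matrix.symplecticGroup l K → Matrix.symplecticGroup l A))
    (U : Subgroup (Matrix.symplecticGroup l A)) (hU : IsOpen (U : Set (Matrix.symplecticGroup l A)))
    (g : Matrix.symplecticGroup l A) :
    ∃ (γ : Matrix.symplecticGroup l K) (u : Matrix.symplecticGroup l A), u ∈ U ∧ mapHom f γ * u = g := by
  have hopen : IsOpen {x : Matrix.symplecticGroup l A | x⁻¹ * g ∈ U} :=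
    hU.preimage (continuous_symplecticGroup_inv.mul continuous_const)
  obtain ⟨γ, hγ⟩ := hφ.exists_mem_open hopen ⟨g, by simp [U.one_mem]⟩
  exact ⟨γ, _, hγ, mul_inv_cancel_left _ _⟩

end Transfer

/-! ### §4. The finite adele ring: strong approximation for `Sp_{2l}` -/

section FiniteAdele

open IsDedekindDomain

variable (R : Type*) [CommRing R] [IsDedekindDomain R] (K : Type*) [Field K] [Algebra R K]
  [IsFractionRing R K]

/-- **The finite adele ring `𝔸_K^∞ = Πʳ_v [K_v, 𝒪_v]` of a Dedekind domain has the big-cell shift property** for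
`Sp_{2l}`: a restricted product of the local rings `K_v` (fields) and `𝒪_v` (valuation rings); the tree's
`bigCellReachable_restrictedProduct` (number-field spelling: `bigCellReachable_finiteAdeleRing`).
[cite: MoeglinVignerasWaldspurger1987, Chap. 2 II.5] -/
theorem FiniteAdeleRing.symplectic_bigCellReachable :
    ∀ ⦃P Q S T : Matrix l l (FiniteAdeleRing R K)⦄,
      fromBlocks P Q S T ∈ Matrix.symplecticGroup l (FiniteAdeleRing R K) →
        ∃ X : Matrix l l (FiniteAdeleRing R K), X.IsSymm ∧ IsUnit (P + X * S).det :=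
  bigCellReachable_restrictedProduct
    (fun v : HeightOneSpectrum R => bigCellReachable_of_isLocalRing (R := v.adicCompletion K))
    (fun v : HeightOneSpectrum R => bigCellReachable_of_isLocalRing (R := v.adicCompletionIntegers K))

/-- **Strong approximation for `Sp_{2n}` (finite adeles): `Sp_{2l}(K)` is dense in `Sp_{2l}(𝔸_K^∞)`** for the
fraction field `K` of a Dedekind domain `R` and every finite index type `l` — Kneser–Platonov for the simply connected
group `G = Sp_{2n}`, `S ⊇` the archimedean places ([PlatonovRapinchuk1994] Thm. 7.12; [Kneser1966]).  Proof: the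
transfer principle `symplecticGroup_denseRange_map_of_denseRange` fed with the density of `K` in `𝔸_K^∞`
(`denseRange_algebraMap_finiteAdeleRing`), strong approximation for `SL_l`
(`specialLinearGroup_denseRange_map_finiteAdeleRing`) and the big cell of the finite adele ring
(`FiniteAdeleRing.symplectic_bigCellReachable`). [cite: PlatonovRapinchuk1994, §7.4 Thm. 7.12 (p. 427)]
[cite: Milne2005ShimuraVarieties, §4 Thm. 4.16 (p. 48)] -/
theorem symplecticGroup_denseRange_map_finiteAdeleRing :
    DenseRange (mapHom (algebraMap K (FiniteAdeleRing R K)) :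
      Matrix.symplecticGroup l K → Matrix.symplecticGroup l (FiniteAdeleRing R K)) :=
  symplecticGroup_denseRange_map_of_denseRange _ (denseRange_algebraMap_finiteAdeleRing R K)
    (specialLinearGroup_denseRange_map_finiteAdeleRing R K) (FiniteAdeleRing.symplectic_bigCellReachable R K)

/-- **`Sp_{2l}(𝔸_K^∞) = Sp_{2l}(K) · U` for every open subgroup `U`** — the form in which strong approximation is
consumed (finitely many / exactly `[𝔸_f^× : ℚ_{>0} ν(K)]` components of `Sh_K(GSp_{2g}, 𝔥_g^±)`, adelisation of Siegel
modular forms): every `g ∈ Sp_{2l}(𝔸_K^∞)` is `γ u` with `γ ∈ Sp_{2l}(K)`, `u ∈ U`.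
[cite: PlatonovRapinchuk1994, §7.4 Thm. 7.12 (p. 427)]
[cite: Milne2005ShimuraVarieties, §4 Prop. 4.18 (proof, p. 48), §5 Lemma 5.13 (p. 57), Thm. 5.17 (p. 59)] -/
theorem exists_symplecticGroup_map_mul_eq_of_isOpen
    (U : Subgroup (Matrix.symplecticGroup l (FiniteAdeleRing R K)))
    (hU : IsOpen (U : Set (Matrix.symplecticGroup l (FiniteAdeleRing R K))))
    (g : Matrix.symplecticGroup l (FiniteAdeleRing R K)) :
    ∃ (γ : Matrix.symplecticGroup l K) (u : Matrix.symplecticGroup l (FiniteAdeleRing R K)), u ∈ U ∧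
      mapHom (algebraMap K (FiniteAdeleRing R K)) γ * u = g :=
  exists_symplecticGroup_map_mul_eq_of_denseRange _ (symplecticGroup_denseRange_map_finiteAdeleRing R K) U hU g

end FiniteAdele

end Literature.NumberTheory.Automorphic

end
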